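import Literature.NumberTheory.DiophantineGeometry.GenEllAnnulus
import HarnessLib

/-!
# [GenEll] Theorem 2.1 for `ℙ¹ ∖ {0,1,∞}` WITH A HEIGHT COEFFICIENT `Λ` — the `With`-predicates, the abc
# dictionary with exponent `Λ`, and the loss-free (annulus) half of (ii) ⇒ (i)

S. Mochizuki, *Arithmetic elliptic curves in general position*, Math. J. Okayama Univ. 52 (2010)
[cite: MochizukiGenEll2010, Thm 2.1 p.11]: Theorem 2.1 equates, for a finite set of primes `Σ`,
(i) the Vojta inequality `ht_{ω_X(D)} ≲ (1+ε)(log-diff_X + log-cond_D)` on `U_X(Q̄)^{≤d}` and (ii) the same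
inequality on the `Σ`-supported compactly bounded subsets of `U_{ℙ¹}`. The tree holds the faithful `ℙ¹`
transcription (`GenEll.VojtaIneq`, `ABCCompactlyBounded`, `VojtaP1Deg`, `GenEll_thm21_primes`, the abc
dictionary `abc_of_vojtaIneq_one`; `GenEllThm21.lean`) and its PROOF (`GenEll_thm21_primes_holds`,
`GenEllThm21PrimesHolds.lean`).

This file is VOCABULARY for the R-H round-2 «exponent programme» of the abc-iut cell (EXP-SPEC.md v0, F1):
the same predicates with a multiplicative HEIGHT COEFFICIENT `Λ` on the whole right-hand side,
`ht ≲ Λ·(1+ε)·(log-diff + log-cond)`, written — ruling R17 — as LITERAL REPARAMETRISATIONS of the record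
`ε`-predicates (`Λ·(1+ε) = 1 + (Λ·(1+ε) − 1)`), so that `Λ = 1` is the record vocabulary definitionally and
every `ε`-explicit lemma of the tree applies verbatim at the shifted `ε`:

* §1 `VojtaIneqWith S d Λ ε := VojtaIneq S d (Λ·(1+ε) − 1)`, `ABCCompactlyBoundedWith S Λ` ((ii)_Λ),
  `VojtaP1DegWith d Λ` ((i)_Λ|_{ℙ¹}), `GenEll_thm21_primesWith Λ` (the SHAPE «(ii)_Λ ⇒ (i)_Λ|_{ℙ¹}» — a
  predicate, asserted by nobody; see §5), with the `Λ = 1` regressions and the shifted-`ε` unfoldings;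
* §2 `ABCWithExponent Λ` — `∀ ε > 0, ∃ C > 0, ∀ abc triples, c < C·rad(abc)^{Λ·(1+ε)}` — and
  `ABCWithExponentOn K Λ` (the same for the triples whose point `λ = a/c` lies in `K ⊆ U_P(Q̄)`);
  `abcWithExponent_one_iff` (at `Λ = 1` it is, word for word, the abc sentence of Masser–Oesterlé as
  displayed in `GenEllThm21.abc_of_vojtaIneq_one`), monotonicity in `Λ`, `abcWithExponentOn_univ_iff`;
* §3 the DICTIONARY with exponent: `abcExpOn_of_vojtaIneqWith` (`d = 1` Vojta-with-`Λ` on `K` ⟹ abc with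
  exponent `Λ` on `K`: `log c ≤ Λ(1+ε)·log rad + K₀`, exponentiate), `abcExp_of_vojtaP1DegWith`,
  `abcExp_of_abcCompactlyBoundedWith` (modulo the `With`-shape of Thm 2.1, taken as a HYPOTHESIS);
* §4 the LOSS-FREE HALF of (ii) ⇒ (i) with the coefficient carried: (ii)_Λ applies VERBATIM — no Belyi
  map — to the points `ρ`-far from the cusps at `∞` and at the primes of `S` (they lie in ONE compactly
  bounded subset, the annulus; port of `vojtaIneq_farFromCusps_of_abcCompactlyBounded`), hence abc with
  exponent `Λ` ON every such family of triples: `abcExpOn_farFromCusps_of_abcCompactlyBoundedWith`;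
* §5 EXPONENT RIGIDITY of the Belyi transfer (why §4 is all that carries `Λ > 1`): the transfer theorem
  of record `vojtaIneq_of_belyi_mechanism` (`GenEllPhiMechanism.lean`, print p. 13) consumes (ii) at a
  source `ε′` under the slope condition `0 < A − (1+ε′)·B_c` with `A − B_c = (e−3)/e` and
  `B_c = (deg β − 1) + 3(deg β + 1)/e ≥ 0`; under (ii)_Λ the source is only available at `ε′ ≥ Λ − 1`,
  and `belyi_slope_not_pos` records that the slope condition then FAILS as soon as
  `(Λ − 1)·B_c ≥ (e−3)/e` — i.e. on every mechanism with `deg β ≥ 1 + 1/(Λ−1)`. So «(ii)_Λ ⇒ (i)_Λ» is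
  not in print and not in reach of the printed mechanism for any `Λ > 1`; `GenEll_thm21_primesWith Λ`
  stays a predicate.

Classical and refereed material ([GenEll] is outside the IUT dispute, Scholze–Stix 2018 §1.2); the
`With`-predicates are hypotheses/targets, never facts; nothing here bears on [IUTchIII] Cor. 3.12 and
nothing asserts abc (with or without exponent) proved or refuted.
-/

noncomputable section

open NumberField IsDedekindDomain

namespace Literature.NumberTheory.DiophantineGeometry.GenEll

/-! ## §1 The `With`-predicates (literal reparametrisations of the record `ε`-predicates) -/

/-- The inequality of BD-classes `ht_{ω_P(C)} ≲ Λ·(1+ε)·(log-diff_P + log-cond_C)` on `S ∩ U_P(Q̄)^{≤d}`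
for `(P, C) = (ℙ¹_ℚ, [0]+[1]+[∞])`, with a HEIGHT COEFFICIENT `Λ` multiplying the whole right-hand side —
by definition the record predicate `VojtaIneq S d ε″` at the shifted `ε″ := Λ·(1+ε) − 1`
(`1 + ε″ = Λ·(1+ε)`). A predicate; nothing is asserted. [cite: MochizukiGenEll2010, Thm 2.1 p.11] -/
def VojtaIneqWith (S : Set NFPoint) (d : ℕ) (Λ ε : ℝ) : Prop :=
  VojtaIneq S d (Λ * (1 + ε) - 1)

/-- **Statement (ii)_Λ** — (ii) of [GenEll] Thm. 2.1 for the finite set of primes `Σ = S` with the height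
coefficient `Λ`: for every `d > 0`, every `ε > 0` and every compactly bounded `K_V ⊆ U_P(Q̄)` whose support
contains `Σ`, `ht ≲ Λ·(1+ε)·(log-diff + log-cond)` on `K_V ∩ U_P(Q̄)^{≤d}`. A predicate; nothing is
asserted. [cite: MochizukiGenEll2010, Thm 2.1 (ii) p.11] -/
def ABCCompactlyBoundedWith (S : Finset ℕ) (Λ : ℝ) : Prop :=
  ∀ d : ℕ, 0 < d → ∀ ε : ℝ, 0 < ε → ∀ D : CBData, D.SupportContains S → VojtaIneqWith D.toSet d Λ ε

/-- **Statement (i)_Λ for `(ℙ¹_ℚ, [0]+[1]+[∞])` and the positive integer `d`**: for every `ε > 0`,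
`ht ≲ Λ·(1+ε)·(log-diff + log-cond)` on all of `U_P(Q̄)^{≤d}`. A predicate; nothing is asserted.
[cite: MochizukiGenEll2010, Thm 2.1 (i) p.11] -/
def VojtaP1DegWith (d : ℕ) (Λ : ℝ) : Prop :=
  ∀ ε : ℝ, 0 < ε → VojtaIneqWith Set.univ d Λ ε

/-- **The SHAPE «(ii)_Λ ⇒ (i)_Λ|_{ℙ¹}» of [GenEll] Thm. 2.1 with a height coefficient**: for every finite set
`Σ` of PRIME numbers, (ii)_Λ at `Σ` implies (i)_Λ|_{ℙ¹} in every degree `d > 0`. At `Λ = 1` this is the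
tree's faithful transcription `GenEll_thm21_primes` (`genEll_thm21_primesWith_one_iff`), which is PROVED
(`GenEll_thm21_primes_holds`). For `Λ > 1` it is NOT a statement of the paper and NOT in reach of the
printed noncritical-Belyi mechanism (exponent rigidity, §5 `belyi_slope_not_pos`): a PREDICATE to be
carried as an explicit hypothesis where wanted, asserted by nobody, never a named fact.
[cite: MochizukiGenEll2010, Thm 2.1 p.11] -/
def GenEll_thm21_primesWith (Λ : ℝ) : Prop :=
  ∀ S : Finset ℕ, (∀ p ∈ S, p.Prime) → ABCCompactlyBoundedWith S Λ → ∀ d : ℕ, 0 < d → VojtaP1DegWith d Λ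

/-- Unfolding: `VojtaIneqWith S d Λ ε` is the BD-inequality `ht ≲ Λ·((1+ε)·(log-diff + log-cond))` on
`S ∩ U_P(Q̄)^{≤d}` (one coefficient convention: `Λ` multiplies the whole right-hand side).
[cite: MochizukiGenEll2010, Thm 2.1 p.11] -/
theorem vojtaIneqWith_iff_bdLe (S : Set NFPoint) (d : ℕ) (Λ ε : ℝ) :
    VojtaIneqWith S d Λ ε ↔
      BDLe (S ∩ UPle d) NFPoint.ht (fun P => Λ * ((1 + ε) * (P.logDiff + P.logCond))) := by
  unfold VojtaIneqWith VojtaIneq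
  have h : (fun P : NFPoint => (1 + (Λ * (1 + ε) - 1)) * (P.logDiff + P.logCond)) =
      fun P => Λ * ((1 + ε) * (P.logDiff + P.logCond)) := by
    funext P; ring
  rw [h]

/-- `Λ = 1` regression (definitional up to `1·(1+ε) − 1 = ε`): `VojtaIneqWith S d 1 ε ↔ VojtaIneq S d ε`.
[cite: MochizukiGenEll2010, Thm 2.1 p.11] -/
theorem vojtaIneqWith_one_iff (S : Set NFPoint) (d : ℕ) (ε : ℝ) :
    VojtaIneqWith S d 1 ε ↔ VojtaIneq S d ε := by
  unfold VojtaIneqWith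
  rw [one_mul, add_sub_cancel_left]

/-- `Λ = 1` regression: `ABCCompactlyBoundedWith S 1 ↔ ABCCompactlyBounded S`. [cite: MochizukiGenEll2010, Thm 2.1 (ii) p.11] -/
theorem abcCompactlyBoundedWith_one_iff (S : Finset ℕ) :
    ABCCompactlyBoundedWith S 1 ↔ ABCCompactlyBounded S := by
  unfold ABCCompactlyBoundedWith ABCCompactlyBounded
  simp only [vojtaIneqWith_one_iff]

/-- `Λ = 1` regression: `VojtaP1DegWith d 1 ↔ VojtaP1Deg d`. [cite: MochizukiGenEll2010, Thm 2.1 (i) p.11] -/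
theorem vojtaP1DegWith_one_iff (d : ℕ) : VojtaP1DegWith d 1 ↔ VojtaP1Deg d := by
  unfold VojtaP1DegWith VojtaP1Deg
  simp only [vojtaIneqWith_one_iff]

/-- `Λ = 1` regression: `GenEll_thm21_primesWith 1 ↔ GenEll_thm21_primes` (the faithful record fact, PROVED in
`GenEllThm21PrimesHolds`). [cite: MochizukiGenEll2010, Thm 2.1 p.11] -/
theorem genEll_thm21_primesWith_one_iff : GenEll_thm21_primesWith 1 ↔ GenEll_thm21_primes := by
  unfold GenEll_thm21_primesWith GenEll_thm21_primes
  simp only [abcCompactlyBoundedWith_one_iff, vojtaP1DegWith_one_iff]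

/-- Restriction of a `With`-inequality to a smaller set of points. [cite: MochizukiGenEll2010, Thm 2.1 p.11] -/
theorem VojtaIneqWith.mono {S S' : Set NFPoint} {d : ℕ} {Λ ε : ℝ} (h : VojtaIneqWith S d Λ ε)
    (hS : S' ⊆ S) : VojtaIneqWith S' d Λ ε :=
  BDLe.mono h (Set.inter_subset_inter_left _ hS)

/-- **(ii)_Λ in the shifted-`ε` currency** (ruling R17; `Λ > 0`): `ABCCompactlyBoundedWith S Λ` iff the record
inequality `VojtaIneq D.toSet d ε″` holds for every `d > 0`, every `ε″ > Λ − 1` and every `K_V ⊇ Σ` — so every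
`ε`-explicit lemma of the tree is reused verbatim at the shifted `ε″`. [cite: MochizukiGenEll2010, Thm 2.1 (ii) p.11] -/
theorem abcCompactlyBoundedWith_iff_shift {S : Finset ℕ} {Λ : ℝ} (hΛ : 0 < Λ) :
    ABCCompactlyBoundedWith S Λ ↔
      ∀ d : ℕ, 0 < d → ∀ ε'' : ℝ, Λ - 1 < ε'' → ∀ D : CBData, D.SupportContains S →
        VojtaIneq D.toSet d ε'' := by
  constructor
  · intro h d hd ε'' hε'' D hD
    have hε : 0 < (1 + ε'') / Λ - 1 := by
      rw [sub_pos, lt_div_iff₀ hΛ]; linarith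
    have key := h d hd _ hε D hD
    unfold VojtaIneqWith at key
    have hid : Λ * (1 + ((1 + ε'') / Λ - 1)) - 1 = ε'' := by field_simp; ring
    rwa [hid] at key
  · intro h d hd ε hε D hD
    exact h d hd _ (by nlinarith) D hD

/-- **(i)_Λ in the shifted-`ε` currency** (`Λ > 0`): `VojtaP1DegWith d Λ ↔ ∀ ε″ > Λ − 1, VojtaIneq univ d ε″`.
[cite: MochizukiGenEll2010, Thm 2.1 (i) p.11] -/
theorem vojtaP1DegWith_iff_shift {d : ℕ} {Λ : ℝ} (hΛ : 0 < Λ) :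
    VojtaP1DegWith d Λ ↔ ∀ ε'' : ℝ, Λ - 1 < ε'' → VojtaIneq Set.univ d ε'' := by
  constructor
  · intro h ε'' hε''
    have hε : 0 < (1 + ε'') / Λ - 1 := by
      rw [sub_pos, lt_div_iff₀ hΛ]; linarith
    have key := h _ hε
    unfold VojtaIneqWith at key
    have hid : Λ * (1 + ((1 + ε'') / Λ - 1)) - 1 = ε'' := by field_simp; ring
    rwa [hid] at key
  · intro h ε hε
    exact h _ (by nlinarith)

/-- **(i)_Λ ⟹ (ii)_Λ** ("immediate from the definitions", as at `Λ = 1`): a BD-inequality on `U_P(Q̄)^{≤d}`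
restricts to `K_V ∩ U_P(Q̄)^{≤d}`. [cite: MochizukiGenEll2010, Thm 2.1 p.11] -/
theorem abcCompactlyBoundedWith_of_vojtaP1DegWith {Λ : ℝ} (h : ∀ d : ℕ, 0 < d → VojtaP1DegWith d Λ)
    (S : Finset ℕ) : ABCCompactlyBoundedWith S Λ :=
  fun d hd ε hε _ _ => (h d hd ε hε).mono (Set.subset_univ _)

/-- (ii)_Λ is ANTITONE in `Σ`: a compactly bounded subset whose support contains `S'` ⊇ `S` has support
containing `S`. [cite: MochizukiGenEll2010, Thm 2.1 (ii) p.11] -/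
theorem abcCompactlyBoundedWith_of_subset {S S' : Finset ℕ} {Λ : ℝ} (hSS' : S ⊆ S')
    (h : ABCCompactlyBoundedWith S Λ) : ABCCompactlyBoundedWith S' Λ :=
  fun d hd ε hε D hD => h d hd ε hε D (hSS'.trans hD)

/-! ## §2 The abc sentence with an exponent, globally and on a set of points -/

/-- **abc WITH EXPONENT `Λ`**: `∀ ε > 0, ∃ C > 0, ∀ abc triples (a, b, c), c < C·rad(abc)^{Λ·(1+ε)}`. At `Λ = 1`
this is, word for word, the abc sentence (Masser–Oesterlé, strong form) displayed in
`GenEll.abc_of_vojtaIneq_one` and in the summit statement (`abcWithExponent_one_iff`). A predicate (an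
abc-TYPE sentence); open for every `Λ`; nothing is asserted. [cite: MochizukiGenEll2010, Thm 2.1 p.11] -/
def ABCWithExponent (Λ : ℝ) : Prop :=
  ∀ ε : ℝ, 0 < ε → ∃ C : ℝ, 0 < C ∧
    ∀ a b c : ℕ, IsABCTriple a b c → (c : ℝ) < C * ((rad a b c : ℕ) : ℝ) ^ (Λ * (1 + ε))

/-- **abc with exponent `Λ` ON THE SET OF POINTS `K ⊆ U_P(Q̄)`**: the same sentence restricted to the abc
triples whose point `λ = a/c ∈ U_P(ℚ)` lies in `K` (e.g. `K` = a compactly bounded subset, or the points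
`ρ`-far from the cusps — §4). A predicate; nothing is asserted. [cite: MochizukiGenEll2010, Thm 2.1 (ii) p.11] -/
def ABCWithExponentOn (K : Set NFPoint) (Λ : ℝ) : Prop :=
  ∀ ε : ℝ, 0 < ε → ∃ C : ℝ, 0 < C ∧
    ∀ a b c : ℕ, IsABCTriple a b c → ratPoint ((a : ℚ) / c) ∈ K →
      (c : ℝ) < C * ((rad a b c : ℕ) : ℝ) ^ (Λ * (1 + ε))

/-- `Λ = 1` regression: `ABCWithExponent 1` is literally the displayed abc sentence
`∀ ε > 0, ∃ C > 0, ∀ abc triples, c < C·rad(abc)^{1+ε}` (the conclusion of `abc_of_vojtaIneq_one`; the summit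
file defines `ABC` by the same display). [cite: MochizukiGenEll2010, Thm 2.1 p.11] -/
theorem abcWithExponent_one_iff :
    ABCWithExponent 1 ↔
      ∀ ε : ℝ, 0 < ε → ∃ C : ℝ, 0 < C ∧
        ∀ a b c : ℕ, IsABCTriple a b c → (c : ℝ) < C * ((rad a b c : ℕ) : ℝ) ^ (1 + ε) := by
  unfold ABCWithExponent
  simp only [one_mul]

/-- On the whole of `U_P`, abc-with-exponent-on is abc with exponent. [cite: MochizukiGenEll2010, Thm 2.1 p.11] -/
theorem abcWithExponentOn_univ_iff (Λ : ℝ) : ABCWithExponentOn Set.univ Λ ↔ ABCWithExponent Λ := by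
  unfold ABCWithExponentOn ABCWithExponent
  simp only [Set.mem_univ, forall_const]

/-- Restriction of abc-with-exponent to a smaller set of points. [cite: MochizukiGenEll2010, Thm 2.1 p.11] -/
theorem ABCWithExponentOn.mono {K K' : Set NFPoint} {Λ : ℝ} (h : ABCWithExponentOn K Λ) (hK : K' ⊆ K) :
    ABCWithExponentOn K' Λ := fun ε hε => by
  obtain ⟨C, hC, hK0⟩ := h ε hε
  exact ⟨C, hC, fun a b c ht hm => hK0 a b c ht (hK hm)⟩

/-- The radical of an abc triple is `≥ 1` (as a real number). [folklore] -/
private theorem one_le_rad (a b c : ℕ) : (1 : ℝ) ≤ ((rad a b c : ℕ) : ℝ) := by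
  have : 0 < rad a b c := by
    rw [rad_def]; exact Nat.pos_of_ne_zero UniqueFactorizationMonoid.radical_ne_zero
  exact_mod_cast this

/-- **Monotonicity in the exponent**: abc with exponent `Λ` on `K` implies abc with exponent `Λ' ≥ Λ` on `K`
(`rad ≥ 1`). [cite: MochizukiGenEll2010, Thm 2.1 p.11] -/
theorem ABCWithExponentOn.of_le {K : Set NFPoint} {Λ Λ' : ℝ} (hΛ : Λ ≤ Λ') (h : ABCWithExponentOn K Λ) :
    ABCWithExponentOn K Λ' := fun ε hε => by
  obtain ⟨C, hC, hK⟩ := h ε hε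
  refine ⟨C, hC, fun a b c ht hm => (hK a b c ht hm).trans_le ?_⟩
  have hε1 : 0 ≤ 1 + ε := by linarith
  exact mul_le_mul_of_nonneg_left
    (Real.rpow_le_rpow_of_exponent_le (one_le_rad a b c) (mul_le_mul_of_nonneg_right hΛ hε1)) hC.le

/-- Monotonicity in the exponent, global form: `ABCWithExponent Λ → ABCWithExponent Λ'` for `Λ ≤ Λ'` — in
particular abc itself (`Λ = 1`) implies abc with every exponent `Λ' ≥ 1`. [cite: MochizukiGenEll2010, Thm 2.1 p.11] -/
theorem ABCWithExponent.of_le {Λ Λ' : ℝ} (hΛ : Λ ≤ Λ') (h : ABCWithExponent Λ) : ABCWithExponent Λ' := by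
  rw [← abcWithExponentOn_univ_iff] at h ⊢
  exact h.of_le hΛ

/-! ## §3 The abc dictionary with exponent `Λ` -/

/-- **Vojta-with-`Λ` in degree `1` on `K` ⟹ abc with exponent `Λ` on `K`.** For an abc triple with
`λ = a/c ∈ K`: `ht(λ) = log c`, `log-diff(λ) = 0`, `log-cond(λ) = log rad(abc)` (`ht_ratPoint_triple`,
`logDiff_ratPoint`, `logCond_ratPoint_triple`), so the BD-inequality reads `log c ≤ Λ(1+ε)·log rad + K₀`;
exponentiate. Port of `abc_of_vojtaIneq_one` with the coefficient carried and the set of points kept. PROVED.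
[cite: MochizukiGenEll2010, Thm 2.1 p.11] -/
theorem abcExpOn_of_vojtaIneqWith {K : Set NFPoint} {Λ : ℝ}
    (h : ∀ ε : ℝ, 0 < ε → VojtaIneqWith K 1 Λ ε) : ABCWithExponentOn K Λ := by
  intro ε hε
  obtain ⟨K₀, hK₀⟩ := (vojtaIneqWith_iff_bdLe K 1 Λ ε).1 (h ε hε)
  refine ⟨Real.exp K₀ + 1, by positivity, fun a b c ht hmem => ?_⟩
  have hc : 0 < c := by obtain ⟨ha, -, habc, -⟩ := ht; omega
  have hc0 : (0 : ℝ) < c := by exact_mod_cast hc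
  have hineq := hK₀ _ ⟨hmem, ratPoint_triple_mem ht⟩
  simp only at hineq
  rw [ht_ratPoint_triple ht, logDiff_ratPoint, logCond_ratPoint_triple ht, zero_add] at hineq
  -- `hineq : log c - Λ * ((1 + ε) * log rad) ≤ K₀`
  have hr0 : (0 : ℝ) < (rad a b c : ℝ) := lt_of_lt_of_le one_pos (one_le_rad a b c)
  have hexp : (c : ℝ) ≤ Real.exp K₀ * (rad a b c : ℝ) ^ (Λ * (1 + ε)) := by
    have e1 : (c : ℝ) = Real.exp (Real.log c) := (Real.exp_log hc0).symm
    have e2 : ((rad a b c : ℕ) : ℝ) ^ (Λ * (1 + ε)) = Real.exp (Real.log (rad a b c) * (Λ * (1 + ε))) :=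
      Real.rpow_def_of_pos hr0 _
    rw [e1, e2, ← Real.exp_add]
    apply Real.exp_le_exp.mpr
    linarith
  have hpow : 0 < ((rad a b c : ℕ) : ℝ) ^ (Λ * (1 + ε)) := Real.rpow_pos_of_pos hr0 _
  calc (c : ℝ) ≤ Real.exp K₀ * (rad a b c : ℝ) ^ (Λ * (1 + ε)) := hexp
    _ < (Real.exp K₀ + 1) * (rad a b c : ℝ) ^ (Λ * (1 + ε)) := by nlinarith

/-- **(i)_Λ|_{ℙ¹} at `d = 1` ⟹ abc with exponent `Λ`** (port of `abc_of_vojtaIneq_one`). PROVED.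
[cite: MochizukiGenEll2010, Thm 2.1 p.11] -/
theorem abcExp_of_vojtaIneqWith_one {Λ : ℝ} (h : ∀ ε : ℝ, 0 < ε → VojtaIneqWith Set.univ 1 Λ ε) :
    ABCWithExponent Λ :=
  (abcWithExponentOn_univ_iff Λ).1 (abcExpOn_of_vojtaIneqWith h)

/-- **(i)_Λ|_{ℙ¹} in every degree ⟹ abc with exponent `Λ`**, by the `d = 1` case (port of `abc_of_vojtaP1Deg`).
PROVED. [cite: MochizukiGenEll2010, Thm 2.1 p.11] -/
theorem abcExp_of_vojtaP1DegWith {Λ : ℝ} (h : ∀ d : ℕ, 0 < d → VojtaP1DegWith d Λ) : ABCWithExponent Λ :=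
  abcExp_of_vojtaIneqWith_one (h 1 one_pos)

/-- **(ii)_Λ at a finite set of primes `Σ` ⟹ abc with exponent `Λ`, MODULO the `With`-shape of Thm. 2.1**
(`GenEll_thm21_primesWith Λ`, an explicit HYPOTHESIS — proved at `Λ = 1` only, not in reach for `Λ > 1`,
§5). [cite: MochizukiGenEll2010, Thm 2.1 p.11] -/
theorem abcExp_of_abcCompactlyBoundedWith {Λ : ℝ} (hshape : GenEll_thm21_primesWith Λ) {S : Finset ℕ}
    (hS : ∀ p ∈ S, p.Prime) (h : ABCCompactlyBoundedWith S Λ) : ABCWithExponent Λ :=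
  abcExp_of_vojtaP1DegWith (hshape S hS h)

/-! ## §4 The loss-free half of (ii) ⇒ (i) with the coefficient carried: points far from the cusps -/

/-- **(ii)_Λ applies VERBATIM on the annulus**: if (ii)_Λ holds at the finite set of primes `Σ = S`, then for
every `d > 0`, `ε > 0` and `0 < ρ ≤ 1/2` the inequality `ht ≲ Λ(1+ε)(log-diff + log-cond)` holds on the points
of `U_P(Q̄)^{≤d}` that are `ρ`-far from the cusps at `∞` and at the primes of `S` — these lie in ONE
compactly bounded subset, the annulus `CBData.annulus S ρ`, to which (ii)_Λ applies directly; NO Belyi map,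
NO loss in the coefficient. Port of `vojtaIneq_farFromCusps_of_abcCompactlyBounded`. PROVED.
[cite: MochizukiGenEll2010, Thm 2.1 p.12] -/
theorem vojtaIneqWith_farFromCusps_of_abcCompactlyBoundedWith {S : Finset ℕ} (hS : ∀ p ∈ S, p.Prime)
    {Λ : ℝ} (h : ABCCompactlyBoundedWith S Λ) {d : ℕ} (hd : 0 < d) {ε : ℝ} (hε : 0 < ε) {ρ : ℝ}
    (h0 : 0 < ρ) (h2 : ρ ≤ 1 / 2) : VojtaIneqWith {P : NFPoint | P.FarFromCusps S ρ} d Λ ε :=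
  (h d hd ε hε (CBData.annulus S hS ρ h0 h2) (CBData.annulus_supportContains S hS ρ h0 h2)).mono
    (setOf_farFromCusps_subset_toSet hS h0 h2)

/-- **(ii)_Λ ⟹ abc WITH EXPONENT `Λ` ON EVERY CUSP-AVOIDING FAMILY OF TRIPLES**: for every `0 < ρ ≤ 1/2`,
`∀ ε > 0, ∃ C = C(ρ, ε) > 0`, `c < C·rad(abc)^{Λ(1+ε)}` for all abc triples whose point `λ = a/c` is
`ρ`-far from the cusps at `∞` and at the primes of `S` (for `S ∋ 2`: `min(a, b) ≥ ρ·c` and the `2`-adic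
valuations of `a/c` and `b/c` in `[log₂ ρ, −log₂ ρ]`). This is the part of «(ii)_Λ ⇒ abc with exponent `Λ`»
that survives with the coefficient intact; no single such family contains all abc triples (one of
`a, b, c` is even, so `λ` is `2`-adically near a cusp at depth `v₂(abc)`), which is why print's (ii) ⇒ (i)
needs the Belyi maps of §5. PROVED. [cite: MochizukiGenEll2010, Thm 2.1 p.12] -/
theorem abcExpOn_farFromCusps_of_abcCompactlyBoundedWith {S : Finset ℕ} (hS : ∀ p ∈ S, p.Prime)
    {Λ : ℝ} (h : ABCCompactlyBoundedWith S Λ) {ρ : ℝ} (h0 : 0 < ρ) (h2 : ρ ≤ 1 / 2) :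
    ABCWithExponentOn {P : NFPoint | P.FarFromCusps S ρ} Λ :=
  abcExpOn_of_vojtaIneqWith fun _ hε =>
    vojtaIneqWith_farFromCusps_of_abcCompactlyBoundedWith hS h one_pos hε h0 h2

/-- The same ON ANY COMPACTLY BOUNDED SUBSET whose support contains `Σ`: (ii)_Λ at `Σ = S` gives abc with
exponent `Λ` on the triples whose point lies in `K_V`. PROVED. [cite: MochizukiGenEll2010, Thm 2.1 (ii) p.11] -/
theorem abcExpOn_toSet_of_abcCompactlyBoundedWith {S : Finset ℕ} {Λ : ℝ} (h : ABCCompactlyBoundedWith S Λ)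
    (D : CBData) (hD : D.SupportContains S) : ABCWithExponentOn D.toSet Λ :=
  abcExpOn_of_vojtaIneqWith fun _ hε => h 1 one_pos _ hε D hD

/-! ## §5 Exponent rigidity of the Belyi transfer (why `GenEll_thm21_primesWith Λ`, `Λ > 1`, is out of reach) -/

/-- **EXPONENT RIGIDITY OF THE BELYI TRANSFER.** The transfer theorem of record
`vojtaIneq_of_belyi_mechanism` (`GenEllPhiMechanism.lean`; print p. 13: `ht_{ω_X} ≲ (1+ε′)(log-diff_X + ht_E)
− ht_E ≈ (1+ε′)·log-diff_X + ε′·ht_E`) consumes statement (ii) at a SOURCE `ε′` under the slope condition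
`0 < A − (1+ε′)·B_c`, where `A − B_c = (e−3)/e` (Riemann–Hurwitz for the cover `D_e`, `e = 2k+1`) and
`B_c = (deg β − 1) + 3(deg β + 1)/e ≥ 0` is the height coefficient of the EXTRA divisor of the noncritical
Belyi map `β` (`mechanismFor_places`: `B_c = ((deg φ+2)(2k+4) − (6k+6))/(2k+1)`); the record proof takes `ε′`
small (`exists_eps_of_margin`). Under (ii)_Λ the source inequality is available only at `ε′ ≥ Λ − 1`
(`abcCompactlyBoundedWith_iff_shift`); this lemma records that the slope condition then FAILS whenever
`(Λ − 1)·B_c ≥ A − B_c` — e.g. on every mechanism with `deg β ≥ 1 + 1/(Λ − 1)`, and such mechanisms occur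
(the Belyi degree is unbounded over the configurations the compactness spine ranges over). Pure real
arithmetic; the content is the reading of the mechanism's binders quoted above. [cite: MochizukiGenEll2010, Thm 2.1 proof p.13] -/
theorem belyi_slope_not_pos {A Bc ε' Λ : ℝ} (hBc : 0 ≤ Bc) (hε' : Λ - 1 ≤ ε')
    (hrig : A - Bc ≤ (Λ - 1) * Bc) : ¬ 0 < A - (1 + ε') * Bc := by
  intro h
  have h1 : (Λ - 1) * Bc ≤ ε' * Bc := mul_le_mul_of_nonneg_right hε' hBc
  nlinarith

/-- The slope condition in closed form: `0 < A − (1+ε′)·B_c ↔ ε′·B_c < A − B_c` — with `A − B_c = (e−3)/e < 1`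
the admissible source coefficients are exactly `ε′ < (e−3)/(e·B_c)`, which tend to `0` as the Belyi degree
grows; at `Λ = 1` print chooses such an `ε′`, for `Λ > 1` none is available once `B_c ≥ 1/(Λ−1)`.
[cite: MochizukiGenEll2010, Thm 2.1 proof p.13] -/
theorem belyi_slope_pos_iff (A Bc ε' : ℝ) : 0 < A - (1 + ε') * Bc ↔ ε' * Bc < A - Bc := by
  constructor <;> intro h <;> nlinarith

end Literature.NumberTheory.DiophantineGeometry.GenEll

end
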